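import Summits.CriticalPhenomena.Statement
import Literature.Probability.Percolation.CriticalContinuity

/-!
# CriticalPhenomena / PercHalfSpace — assemblies

Route `CriticalPhenomena/PercHalfSpace`, items `stmt-CriticalPhenomena-0674` (rank 1, half-space
assembly) and `stmt-CriticalPhenomena-0676` (rank 4, slab assembly). With the
Barsky–Grimmett–Newman fact `θ_ℍ(p_c(ℤ³)) = 0` (Grimmett 1999, Thm (7.35) with `p_c(ℍ) = p_c`,
p. 162) — respectively the Duminil-Copin–Sidoravicius–Tassion slab fact
`∀ k, θ_{S_k}(p_c(ℤ³)) = 0` (CPAM 69 (2016), Thm 1, plus `p_c(ℤ³) ≤ p_c(S_k)`) — as a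
hypothesis, the transfer statement "full-space percolation at `p` ⇒ half-space (resp. some slab)
percolation at the same `p`" gives `PercolationContinuityZ3` (`θ_{ℤ³}(p_c) = 0`): `θ ≥ 0` is a
probability, and `θ(p_c) > 0` would transfer to the half-space/slab, contradicting the fact.
-/

namespace CriticalPhenomena.PercHalfSpace

open Literature.Probability.LatticeModels Literature.Probability.Percolation

/-- Settles `stmt-CriticalPhenomena-0674` (exact signature): (BGN: `θ_ℍ(p_c(ℤ³)) = 0`) →
(half-space transfer `X_P1`) → `PercolationContinuityZ3`. [folklore] -/
theorem percolationContinuityZ3_of_halfSpace_transfer :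
    (Literature.Probability.Percolation.theta ((Literature.Probability.LatticeModels.zdGraph 3).induce {x | 0 ≤ x 0})
        ⟨0, Set.mem_setOf.mpr le_rfl⟩ (Literature.Probability.Percolation.criticalProbI 3) = 0) →
      (∀ p : unitInterval, 0 < Literature.Probability.Percolation.theta (Literature.Probability.LatticeModels.zdGraph 3) 0 p →
        0 < Literature.Probability.Percolation.theta ((Literature.Probability.LatticeModels.zdGraph 3).induce {x | 0 ≤ x 0})
          ⟨0, Set.mem_setOf.mpr le_rfl⟩ p) →
        _root_.PercolationContinuityZ3 := by
  intro hBGN hX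
  by_contra hne
  have hpos : 0 < theta (zdGraph 3) 0 (Literature.Probability.Percolation.criticalProbI 3) :=
    lt_of_le_of_ne MeasureTheory.measureReal_nonneg (Ne.symm hne)
  exact (hX _ hpos).ne' hBGN

/-- Settles `stmt-CriticalPhenomena-0676` (exact signature): (DST + monotonicity:
`∀ k, θ_{S_k}(p_c(ℤ³)) = 0`) → (slab transfer without sprinkling) → `PercolationContinuityZ3`.
[folklore] -/
theorem percolationContinuityZ3_of_slab_transfer :
    (∀ k : ℕ, Literature.Probability.Percolation.theta ((Literature.Probability.LatticeModels.zdGraph 3).induce {x | 0 ≤ x 0 ∧ x 0 ≤ (k : ℤ)})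
        ⟨0, ⟨le_rfl, Int.natCast_nonneg k⟩⟩ (Literature.Probability.Percolation.criticalProbI 3) = 0) →
      (∀ p : unitInterval, 0 < Literature.Probability.Percolation.theta (Literature.Probability.LatticeModels.zdGraph 3) 0 p →
        ∃ k : ℕ, 0 < Literature.Probability.Percolation.theta
          ((Literature.Probability.LatticeModels.zdGraph 3).induce {x | 0 ≤ x 0 ∧ x 0 ≤ (k : ℤ)})
          ⟨0, ⟨le_rfl, Int.natCast_nonneg k⟩⟩ p) →
        _root_.PercolationContinuityZ3 := by
  intro hS hX
  by_contra hne
  have hpos : 0 < theta (zdGraph 3) 0 (Literature.Probability.Percolation.criticalProbI 3) :=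
    lt_of_le_of_ne MeasureTheory.measureReal_nonneg (Ne.symm hne)
  obtain ⟨k, hk⟩ := hX _ hpos
  exact hk.ne' (hS k)

end CriticalPhenomena.PercHalfSpace
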